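import Summits.QuantumAdvantage.AdviceFreeQNC0.Pinned39
import Summits.QuantumAdvantage.AdviceFreeQNC0.RegisterPathSum
import Summits.QuantumAdvantage.AdviceFreeQNC0.TwistBoundX3LocalProof
import HarnessLib

/-!
# Tree port (qn-prover-3 g24), PART 2 of planner qa-qnc0-p1 g39's custody file `qa-qnc0-p1/exp39/Pinned39.lean`
# (sha 36223f84e4fcab77), verbatim; part 1 = `Pinned39.lean`.  See the module docstring of part 1 for the mathematics.
-/

noncomputable section

namespace Summit.QuantumAdvantage.AdviceFreeQNC0

open Finset Literature.Computability.QuantumComplexity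

namespace BondTwist3

variable {r : ℕ}

section ConstOutputs

open Literature.Computability.MetaComplexity Literature.Computability.QuantumComplexity.RingHLF
open TransferWalk ConstBells TwistedTransfer

variable {n : ℕ}

/-- `±1` of a bit. -/
def chi (c : Bool) : ℂ := if c then -1 else 1

/-- auxiliary lemma `chi_true` (planner p1 g39, exp39; ported verbatim). -/
@[simp] theorem chi_true : chi true = -1 := rfl
/-- auxiliary lemma `chi_false` (planner p1 g39, exp39; ported verbatim). -/
@[simp] theorem chi_false : chi false = 1 := rfl

/-- auxiliary lemma `chi_xor` (planner p1 g39, exp39; ported verbatim). -/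
theorem chi_xor (a c : Bool) : chi (xor a c) = chi a * chi c := by
  cases a <;> cases c <;> simp [chi]

/-- auxiliary lemma `norm_chi` (planner p1 g39, exp39; ported verbatim). -/
theorem norm_chi (c : Bool) : ‖chi c‖ = 1 := by cases c <;> simp [chi]

/-- `sgnF v κ s τ = chi (v ∧ [κ + s + τ ≠ 0])`. -/
theorem sgnF_eq_chi (v : Bool) (κ s τ : ZMod 3) : sgnF v κ s τ = chi (v && decide (κ + s + τ ≠ 0)) := by
  unfold sgnF chi
  by_cases h : κ + s + τ ≠ 0
  · cases v <;> simp [h]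
  · push Not at h
    cases v <;> simp [h]

/-- Liveness bit of the bell at the current site, from the state before its letter (`st = −σ.1`). -/
def liveCur (κ τ : ZMod 3) (σ : RegState 0) : Bool := decide (κ + (-σ.1) + τ ≠ 0)

/-- Liveness bit of the PREVIOUS bell: `st_{m−1} = st_m − 1 − [u_{m−1}]` (`u_{m−1} = σ.2.1`); at site `0` the previous bell is
bell `n`, live iff `κ + 2τ ≠ 0` on the event `st u n = τ`. -/
def livePrev (κ τ : ZMod 3) (m : ℕ) (σ : RegState 0) : Bool :=
  if m = 0 then decide (κ + τ + τ ≠ 0) else decide (κ + (-σ.1 - 1 - (if σ.2.1 then 1 else 0)) + τ ≠ 0)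

/-- **The constant-output site sign** `c_m = (b_m ∧ L_m) ⊕ (x ∧ (L_m ⊕ L_{m−1}))`. -/
def epsZ (b : ℕ → Bool) (κ τ : ZMod 3) (m : ℕ) (σ : RegState 0) (x : Bool) : Bool :=
  xor (b m && liveCur κ τ σ) (x && xor (liveCur κ τ σ) (livePrev κ τ m σ))

/-- The `ℕ`-indexed output vector (`false` beyond the bells). -/
def bN (b : Fin (n + 1) → Bool) (m : ℕ) : Bool := if h : m < n + 1 then b ⟨m, h⟩ else false

/-- The walk-frame bell of constant outputs `b`: `y_g(u) = b_g ⊕ tGuess(xOfU u)_g`. -/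
def yConst (b : Fin (n + 1) → Bool) (g : Fin (n + 1)) (u : Fin n → Bool) : Bool := xor (b g) (tGuess (xOfU u) g)

/-- The liveness bits along the true trajectory. -/
def Lb (κ τ : ZMod 3) (u : Fin n → Bool) (m : ℕ) : Bool := decide (κ + st u m + τ ≠ 0)

/-- auxiliary lemma `liveCur_stU` (planner p1 g39, exp39; ported verbatim). -/
theorem liveCur_stU (κ τ : ZMod 3) (u : Fin n → Bool) (m : ℕ) : liveCur κ τ (stU 0 u m) = Lb κ τ u m := by
  unfold liveCur Lb stU; simp

/-- auxiliary lemma `livePrev_stU_succ` (planner p1 g39, exp39; ported verbatim). -/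
theorem livePrev_stU_succ (κ τ : ZMod 3) (u : Fin n → Bool) {m : ℕ} (hm : m < n) :
    livePrev κ τ (m + 1) (stU 0 u (m + 1)) = Lb κ τ u m := by
  unfold livePrev Lb stU sPrev
  rw [if_neg (by omega), st_succ u hm]
  simp only [Nat.add_sub_cancel, if_neg (show m + 1 ≠ 0 by omega)]
  rw [NPGamma37Proof.uExt_of_lt u hm]
  congr 2
  cases u ⟨m, hm⟩ <;> simp

/-- auxiliary lemma `livePrev_stU_zero` (planner p1 g39, exp39; ported verbatim). -/
theorem livePrev_stU_zero (κ τ : ZMod 3) (u : Fin n → Bool) (hτ : st u n = τ) :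
    livePrev κ τ 0 (stU 0 u 0) = Lb κ τ u n := by
  unfold livePrev Lb; rw [if_pos rfl, hτ]

/-- The letters of `u` (as a stream) at a cut. -/
theorem xs_fin (u : Fin n → Bool) (g : Fin (n + 1)) : xs u g.val = xOfU u g := by
  unfold xs; rw [dif_pos g.isLt]

/-- `prv` is a bijection of `Fin (n+1)` (left inverse of `nxt`). -/
theorem prv_bijective : Function.Bijective (prv (n := n + 1)) :=
  Finite.injective_iff_bijective.1 (Function.LeftInverse.injective (g := nxt) nxt_prv)

/-- auxiliary lemma `prv_val_zero` (planner p1 g39, exp39; ported verbatim). -/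
theorem prv_val_zero : (prv (0 : Fin (n + 1))).val = n := by
  simp [prv]

/-- auxiliary lemma `prv_val_succ` (planner p1 g39, exp39; ported verbatim). -/
theorem prv_val_succ (g : Fin (n + 1)) (hg : g.val ≠ 0) : (prv g).val = g.val - 1 := by
  have := g.isLt
  simp only [prv]
  rw [show g.val + (n + 1) - 1 = (g.val - 1) + (n + 1) by omega, Nat.add_mod_right, Nat.mod_eq_of_lt (by omega)]

/-- **Re-association of the win sign of constant outputs** (on the event `st u n = τ`):
`Π_g sgnF (y_g) κ (st u g) τ = Π_{m ≤ n} chi (epsZ b κ τ m (stU 0 u m) (x_m))`. -/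
theorem sign_reassoc (b : Fin (n + 1) → Bool) (κ τ : ZMod 3) (u : Fin n → Bool) (hτ : st u n = τ) :
    (∏ g : Fin (n + 1), sgnF (yConst b g u) κ (st u g.val) τ) =
      ∏ m ∈ range (n + 1), chi (epsZ (bN b) κ τ m (stU 0 u m) (xs u m)) := by
  classical
  -- Step 1: each factor as `chi` of three bits
  have h1 : ∀ g : Fin (n + 1), sgnF (yConst b g u) κ (st u g.val) τ =
      chi (b g && Lb κ τ u g.val) * chi (xOfU u g && Lb κ τ u g.val) * chi (xOfU u (nxt g) && Lb κ τ u g.val) := by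
    intro g
    rw [sgnF_eq_chi, ← chi_xor, ← chi_xor]
    unfold yConst tGuess Lb
    congr 1
    generalize b g = p; generalize xOfU u g = q; generalize xOfU u (nxt g) = s
    generalize decide (κ + st u g.val + τ ≠ 0) = L
    cases p <;> cases q <;> cases s <;> cases L <;> rfl
  rw [prod_congr rfl fun g _ => h1 g, prod_mul_distrib, prod_mul_distrib]
  -- Step 2: reindex the third product by `g = prv j`
  have h2 : (∏ g : Fin (n + 1), chi (xOfU u (nxt g) && Lb κ τ u g.val)) =
      ∏ j : Fin (n + 1), chi (xOfU u j && Lb κ τ u (prv j).val) := by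
    rw [← (Equiv.ofBijective _ prv_bijective).prod_comp (fun g => chi (xOfU u (nxt g) && Lb κ τ u g.val))]
    refine prod_congr rfl fun j _ => ?_
    simp [nxt_prv]
  rw [h2, ← prod_mul_distrib, ← prod_mul_distrib, ← Fin.prod_univ_eq_prod_range
    (fun m => chi (epsZ (bN b) κ τ m (stU 0 u m) (xs u m))) (n + 1)]
  refine prod_congr rfl fun j _ => ?_
  -- Step 3: per-letter Bool identity
  rw [← chi_xor, ← chi_xor]
  have hb : bN b j.val = b j := by unfold bN; rw [dif_pos j.isLt]
  have hx : xs u j.val = xOfU u j := xs_fin u j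
  have hL : liveCur κ τ (stU 0 u j.val) = Lb κ τ u j.val := liveCur_stU κ τ u j.val
  have hP : livePrev κ τ j.val (stU 0 u j.val) = Lb κ τ u (prv j).val := by
    by_cases hj : j.val = 0
    · rw [hj, livePrev_stU_zero κ τ u hτ]
      have : (prv j).val = n := by
        have e : j = 0 := Fin.ext hj
        rw [e]; exact prv_val_zero
      rw [this]
    · obtain ⟨m, hm⟩ : ∃ m, j.val = m + 1 := ⟨j.val - 1, by omega⟩
      have hmn : m < n := by have := j.isLt; omega
      rw [hm, livePrev_stU_succ κ τ u hmn, prv_val_succ j hj, hm, Nat.add_sub_cancel]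
  unfold epsZ
  rw [hb, hx, hL, hP]
  generalize b j = p; generalize xOfU u j = q; generalize Lb κ τ u j.val = L; generalize Lb κ τ u (prv j).val = L'
  cases p <;> cases q <;> cases L <;> cases L' <;> rfl


/-! ### Site weights, final vector and the pointwise identity (pins included)

A master switch `on : Bool` multiplies every sign bit: `on = true` is the signed sum `(−1)^{WIN}`, `on = false` the unsigned
mass `Z` (needed for `[WIN] = (Z − S)/2`). -/

/-- The pin factor of letter `m` with value `x`: `[x = ξ m]` if `m` is pinned, else `1`. -/
def pinF (pn ξ : ℕ → Bool) (m : ℕ) (x : Bool) : ℂ := if pn m = true then (if x = ξ m then 1 else 0) else 1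

/-- auxiliary lemma `norm_pinF_le` (planner p1 g39, exp39; ported verbatim). -/
theorem norm_pinF_le (pn ξ : ℕ → Bool) (m : ℕ) (x : Bool) : ‖pinF pn ξ m x‖ ≤ 1 := by
  unfold pinF; split_ifs <;> simp

/-- **Site weights** of the constant-output chain: pin factor × sign × letter phase. -/
def WZ (on : Bool) (γ : Fin (n + 1) → ZMod 3) (b : Fin (n + 1) → Bool) (κ τ : ZMod 3) (pn ξ : ℕ → Bool)
    (m : ℕ) (σ : RegState 0) (x : Bool) : ℂ :=
  pinF pn ξ m x * (chi (on && epsZ (bN b) κ τ m σ x) * (if x then phase γ m else 1))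

/-- **Final vector**: letter `n` is the final spin (`xs_last`): its pin factor, sign and phase, times the resolved event `[st = τ]`. -/
def fZ (on : Bool) (γ : Fin (n + 1) → ZMod 3) (b : Fin (n + 1) → Bool) (κ τ : ZMod 3) (pn ξ : ℕ → Bool)
    (σ : RegState 0) : ℂ :=
  pinF pn ξ n σ.2.1 * (chi (on && epsZ (bN b) κ τ n σ σ.2.1) * (if σ.2.1 then phase γ n else 1)) *
    (if -σ.1 = τ then 1 else 0)

/-- auxiliary lemma `norm_WZ_le` (planner p1 g39, exp39; ported verbatim). -/
theorem norm_WZ_le (on : Bool) (γ : Fin (n + 1) → ZMod 3) (b : Fin (n + 1) → Bool) (κ τ : ZMod 3) (pn ξ : ℕ → Bool)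
    (m : ℕ) (σ : RegState 0) (x : Bool) : ‖WZ on γ b κ τ pn ξ m σ x‖ ≤ 1 := by
  unfold WZ
  rw [norm_mul, norm_mul, norm_chi]
  have h2 : ‖(if x then phase γ m else 1 : ℂ)‖ ≤ 1 := by
    split_ifs
    · exact norm_phase_le_one γ m
    · simp
  exact mul_le_one₀ (norm_pinF_le pn ξ m x) (by positivity) (by rw [one_mul]; exact h2)

/-- auxiliary lemma `norm_fZ_le` (planner p1 g39, exp39; ported verbatim). -/
theorem norm_fZ_le (on : Bool) (γ : Fin (n + 1) → ZMod 3) (b : Fin (n + 1) → Bool) (κ τ : ZMod 3) (pn ξ : ℕ → Bool)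
    (σ : RegState 0) : ‖fZ on γ b κ τ pn ξ σ‖ ≤ 1 := by
  unfold fZ
  rw [norm_mul, norm_mul, norm_mul, norm_chi]
  have h2 : ‖(if σ.2.1 then phase γ n else 1 : ℂ)‖ ≤ 1 := by
    split_ifs
    · exact norm_phase_le_one γ n
    · simp
  have h3 : ‖(if -σ.1 = τ then (1 : ℂ) else 0)‖ ≤ 1 := by split_ifs <;> simp
  exact mul_le_one₀ (mul_le_one₀ (norm_pinF_le pn ξ n _) (by positivity) (by rw [one_mul]; exact h2))
    (norm_nonneg _) h3

/-- At a pinned site the weight is a PIN weight. -/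
theorem WZ_eq_pinW (on : Bool) (γ : Fin (n + 1) → ZMod 3) (b : Fin (n + 1) → Bool) (κ τ : ZMod 3) (pn ξ : ℕ → Bool)
    {m : ℕ} (hm : pn m = true) :
    WZ on γ b κ τ pn ξ m =
      pinW (ξ m) (fun σ x => chi (on && epsZ (bN b) κ τ m σ x) * (if x then phase γ m else 1)) := by
  funext σ x
  unfold WZ pinW pinF
  rw [if_pos hm]
  by_cases hx : x = ξ m
  · rw [if_pos hx, if_pos hx, one_mul]
  · rw [if_neg hx, if_neg hx, zero_mul]

/-- At a free site the weight is of sign-and-phase form. -/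
theorem WZ_eq_signW (on : Bool) (γ : Fin (n + 1) → ZMod 3) (b : Fin (n + 1) → Bool) (κ τ : ZMod 3) (pn ξ : ℕ → Bool)
    {m : ℕ} (hm : ¬ pn m = true) :
    WZ on γ b κ τ pn ξ m = signW (phase γ m) (fun σ x => on && epsZ (bN b) κ τ m σ x) := by
  funext σ x
  unfold WZ signW pinF chi
  rw [if_neg hm, one_mul]

/-- **THE POINTWISE IDENTITY (constant outputs, pins, `r = 0`, master switch `on`)**. -/
theorem pointwise_eqZ (on : Bool) (γ : Fin (n + 1) → ZMod 3) (b : Fin (n + 1) → Bool) (κ τ : ZMod 3) (pn ξ : ℕ → Bool)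
    (u : Fin n → Bool) :
    (∏ m ∈ range (n + 1), pinF pn ξ m (xs u m)) *
      ((ZMod.stdAddChar (∑ i : Fin (n + 1), if xOfU u i then γ i else 0) : ℂ) *
        ((if st u n = τ then (1 : ℂ) else 0) * ∏ g : Fin (n + 1), sgnF (on && yConst b g u) κ (st u g.val) τ)) =
      pathW (WZ on γ b κ τ pn ξ) (fZ on γ b κ τ pn ξ) 0 (initState 0) n (xs u) := by
  classical
  unfold pathW
  rw [traj_xs u n le_rfl]
  have hfin : fZ on γ b κ τ pn ξ (stU 0 u n) =
      pinF pn ξ n (xs u n) * (chi (on && epsZ (bN b) κ τ n (stU 0 u n) (xs u n)) * (if xs u n then phase γ n else 1)) *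
        (if st u n = τ then 1 else 0) := by
    unfold fZ
    have e2 : (stU 0 u n).2.1 = xs u n := by rw [xs_last]; rfl
    have e1 : -(stU 0 u n).1 = st u n := by unfold stU; simp
    rw [e2, e1]
  have htraj : ∀ m ∈ range n, WZ on γ b κ τ pn ξ (0 + m) (traj (xs u) (initState 0) m) (xs u m) =
      pinF pn ξ m (xs u m) *
        (chi (on && epsZ (bN b) κ τ m (stU 0 u m) (xs u m)) * (if xs u m then phase γ m else 1)) := by
    intro m hm
    rw [mem_range] at hm
    rw [zero_add, traj_xs u m hm.le]
    rfl
  rw [prod_congr rfl htraj, prod_mul_distrib, prod_mul_distrib, hfin]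
  by_cases hτ : st u n = τ
  · have hsign : (∏ g : Fin (n + 1), sgnF (on && yConst b g u) κ (st u g.val) τ) =
        ∏ m ∈ range (n + 1), chi (on && epsZ (bN b) κ τ m (stU 0 u m) (xs u m)) := by
      cases on
      · simp only [Bool.false_and, chi_false, prod_const_one]
        exact prod_eq_one fun g _ => by unfold sgnF; simp
      · simp only [Bool.true_and]; exact sign_reassoc b κ τ u hτ
    rw [if_pos hτ, hsign]
    have hphase : (∏ m ∈ range n, (if xs u m then phase γ m else 1 : ℂ)) * (if xs u n then phase γ n else 1) =
        (ZMod.stdAddChar (∑ i : Fin (n + 1), if xOfU u i then γ i else 0) : ℂ) := by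
      rw [char_eq_prod, ← Finset.prod_range_succ (fun m => (if xs u m then phase γ m else 1 : ℂ)) n,
        ← Fin.prod_univ_eq_prod_range (fun m => (if xs u m then phase γ m else 1 : ℂ)) (n + 1)]
      refine prod_congr rfl fun i _ => ?_
      rw [xs_fin u i]
    rw [← hphase, prod_range_succ (fun m => pinF pn ξ m (xs u m)) n,
      prod_range_succ (fun m => chi (on && epsZ (bN b) κ τ m (stU 0 u m) (xs u m))) n]
    ring
  · rw [if_neg hτ]
    simp

/-- auxiliary lemma `phase_ne_one_of_gammaN` (planner p1 g39, exp39; ported verbatim). -/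
theorem phase_ne_one_of_gammaN (γ : Fin (n + 1) → ZMod 3) {j : ℕ} (h : gammaN γ j ≠ 0) : phase γ j ≠ 1 := by
  unfold gammaN at h; unfold phase
  by_cases hj : j < n + 1
  · rw [dif_pos hj] at h; rw [dif_pos hj]; exact stdAddChar_ne_one h
  · rw [dif_neg hj] at h; exact absurd rfl h

/-- **CORE BOUND (constant outputs, pins)**: the `τ`-resolved pinned twisted (un)signed sum in walk coordinates is
`≤ √6 · ρ^{#twisted free sites < n} · 2ⁿ / 2^{#pinned sites < n}`. -/
theorem core_boundZ {ρ : ℝ} (hρ0 : 0 ≤ ρ) (hρ : SiteContracts ρ) (on : Bool) (γ : Fin (n + 1) → ZMod 3)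
    (b : Fin (n + 1) → Bool) (κ τ : ZMod 3) (pn ξ : ℕ → Bool) :
    ‖∑ u : Fin n → Bool, (∏ m ∈ range (n + 1), pinF pn ξ m (xs u m)) *
        ((ZMod.stdAddChar (∑ i : Fin (n + 1), if xOfU u i then γ i else 0) : ℂ) *
          ((if st u n = τ then (1 : ℂ) else 0) * ∏ g : Fin (n + 1), sgnF (on && yConst b g u) κ (st u g.val) τ))‖ ≤
      Real.sqrt 6 * ρ ^ (siteCnt (fun j => gammaN γ j ≠ 0 ∧ ¬ pn j = true) 0 n) * (2 : ℝ) ^ n /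
        (2 : ℝ) ^ (siteCnt (fun j => pn j = true) 0 n) := by
  have hsum : ∑ u : Fin n → Bool, (∏ m ∈ range (n + 1), pinF pn ξ m (xs u m)) *
        ((ZMod.stdAddChar (∑ i : Fin (n + 1), if xOfU u i then γ i else 0) : ℂ) *
          ((if st u n = τ then (1 : ℂ) else 0) * ∏ g : Fin (n + 1), sgnF (on && yConst b g u) κ (st u g.val) τ)) =
      ∑ bb : Fin n → Bool, pathW (WZ on γ b κ τ pn ξ) (fZ on γ b κ τ pn ξ) 0 (initState 0) n (extB bb) := by
    rw [Finset.sum_congr rfl fun u _ => pointwise_eqZ on γ b κ τ pn ξ u]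
    have e1 : ∀ u : Fin n → Bool, pathW (WZ on γ b κ τ pn ξ) (fZ on γ b κ τ pn ξ) 0 (initState 0) n (xs u) =
        pathW (WZ on γ b κ τ pn ξ) (fZ on γ b κ τ pn ξ) 0 (initState 0) n (extB (letters u)) :=
      fun u => pathW_congr _ _ 0 (initState 0) n fun m hm => (extB_letters u hm).symm
    rw [Finset.sum_congr rfl fun u _ => e1 u,
      sum_letters (fun bb => pathW (WZ on γ b κ τ pn ξ) (fZ on γ b κ τ pn ξ) 0 (initState 0) n (extB bb))]
  rw [hsum]
  refine norm_sum_pathW_mixed_le hρ0 hρ (WZ on γ b κ τ pn ξ) (norm_WZ_le on γ b κ τ pn ξ) (fun j => pn j = true)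
    (fun j => gammaN γ j ≠ 0) (fun j hj => ⟨ξ j, _, fun σ x => ?_, WZ_eq_pinW on γ b κ τ pn ξ hj⟩)
    (fun j hj hnp => ⟨phase γ j, _, phase_cube γ j, phase_ne_one_of_gammaN γ hj, WZ_eq_signW on γ b κ τ pn ξ hnp⟩)
    (fZ on γ b κ τ pn ξ) (norm_fZ_le on γ b κ τ pn ξ) (initState 0) n 0
  rw [norm_mul, norm_chi, one_mul]
  split_ifs
  · exact norm_phase_le_one γ j
  · simp

/-! ### From the walk frame to the letters: `[WIN] = (Z − S)/2` -/

/-- The unsigned resolution: `Σ_τ [st u n = τ]·Π 1 = 1`. -/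
theorem sum_resolve_off (κ : ZMod 3) (b : Fin (n + 1) → Bool) (u : Fin n → Bool) :
    ∑ τ : ZMod 3, (if st u n = τ then (1 : ℂ) else 0) *
        ∏ g : Fin (n + 1), sgnF (false && yConst b g u) κ (st u g.val) τ = 1 := by
  have h1 : ∀ τ : ZMod 3, (∏ g : Fin (n + 1), sgnF (false && yConst b g u) κ (st u g.val) τ) = 1 :=
    fun τ => prod_eq_one fun g _ => by unfold sgnF; simp
  simp_rw [h1, mul_one]
  rw [Finset.sum_ite_eq univ (st u n) (fun _ => (1 : ℂ)), if_pos (mem_univ _)]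

end ConstOutputs

end BondTwist3

end Summit.QuantumAdvantage.AdviceFreeQNC0
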